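import Literature.NumberTheory.EllipticCurves.Sprung2017.HalfLogarithmMatrixInvolutionOffDiagLowerProofs
import HarnessLib

/-!
# Sprung 2017, §3.4 (Prop. 3.14) at `(p, a_p) = (3, 3b)`: the lower off-diagonal entry of the transition matrix is
# `M₁₀ = 3·T·Φ₃(1+T)²·(unit)` when `3 ∤ b` — proofs only

A *proofs* companion (theorems only; no definition, no named fact) of the four `HalfLogarithmMatrixInvolution*Proofs`
files (p634584, p638807, p641447, p644504: `ℒ = M·ℒ(T^ι)` with a UNIQUE integral `M`, `M ≡ 1 (mod T)`, `M₀₁ = 3T·(unit)`,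
`M₁₀ = 3T·g` with `g(0) ≠ 0`).

## What is proved

The ♭-row `v_n` of `𝒞_1⋯𝒞_n` has `v_1 = 0`, `v_2 = −Φ_3(1+T)`, `v_3 = −a·Φ_3(1+T)`, and the recursion is linear, so
`Φ_3(1+T) ∣ v_n` for every `n ≥ 2` (§1, any `a`); hence `Φ_3(1+T)² ∣ v_n v_{n+1}` for EVERY `n`, so the twist factors have
`(E_{n+1})₁₀ = −T·g·v_n v_{n+1} ∈ Φ_3(1+T)²·ℤ[T]` and, inductively, `Φ_3(1+T)² ∣ (M_n)₁₀` (§2). Carrying the quotient through the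
compactness limit (§3–§4) and using the uniqueness of the transition matrix (p644504):

* **`exists_integral_halfLogMatrix_lower_eq_mul_cyclotomic_sq`** — there is a transition matrix with `M₁₀ = Φ_3(1+T)²·H`;
* **`exists_integral_halfLogMatrix_offDiag_final`** — for `3 ∤ b`: `M₀₁ = C(3)·T·u` and
  **`M₁₀ = C(3)·T·Φ_3(1+T)²·h` with `u, h ∈ Λˣ`** (`h(0) ≡ 4b mod 9`), `M₀₀(0) = M₁₁(0) = 1`. So `λ(M₁₀/3T) = 4` and the
  four zeros of `M₁₀/3T` in the open disc are `ζ₃ − 1, ζ̄₃ − 1`, each twice.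

CONSUMER (Summits side, crux `SprungLowerDivisibilityAtThree`, line `chromatic-common-zeros`): the ♯-row becomes
`κ′·L♯(T^ι) − m₀₀·L♯ = 3T·Φ_3(1+T)²·h·L♭`: off the three primes `(3)`, `(T)`, `(Φ_3(1+T))` the two colours are symmetric
(ι-paired zeros of either colour = common zeros), while at `(Φ_3(1+T))` only «♭ ⟹ ♯» holds. HONEST FRAMING: elementary algebra +
compactness about the tree's own definitions; `p = 3`; nothing about any curve; BSD is not proved by any of this.

References: [Sprung2017] §3.1, §3.4 Prop. 3.14, Cor. 4.4, Cor. 4.6; [GreenbergLNM1716] §1.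
-/

noncomputable section

open scoped MatrixGroups

open Polynomial Filter Topology Literature.Barriers.BirchSwinnertonDyer

namespace Literature.NumberTheory.EllipticCurves.Sprung2017

/-! ## §1 `Φ_3(1+T) ∣ v_n` for `n ≥ 2` -/

section Divisibility

/-- **`Φ_p(1+T) ∣ v_{n+2}`** for every `n` and every `a` (`v_2 = −Φ_p(1+T)`, `v_3 = −aΦ_p(1+T)`, linear recursion).
[cite: Sprung2017, Cor. 4.4] -/
theorem cyclotomic_comp_dvd_flatPoly_add_two (a : ℤ) (p : ℕ) (n : ℕ) :
    (cyclotomic p ℤ).comp (X + 1) ∣ flatPoly a p (n + 2) := by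
  -- two consecutive indices at once
  suffices h : (cyclotomic p ℤ).comp (X + 1) ∣ flatPoly a p (n + 2) ∧
      (cyclotomic p ℤ).comp (X + 1) ∣ flatPoly a p (n + 3) from h.1
  induction n with
  | zero =>
    have h2 : flatPoly a p 2 = -(cyclotomic p ℤ).comp (X + 1) := by rw [flatPoly_two, pow_one]
    refine ⟨⟨-1, by rw [h2]; ring⟩, ?_⟩
    rw [show (3 : ℕ) = 1 + 2 from rfl, flatPoly_add_two, flatPoly_one, mul_zero, sub_zero, show 1 + 1 = 2 from rfl, h2]
    exact ⟨-C a, by ring⟩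
  | succ n ih =>
    obtain ⟨h0, h1⟩ := ih
    refine ⟨by simpa using h1, ?_⟩
    rw [show n + 1 + 3 = (n + 2) + 2 from by ring, flatPoly_add_two, show n + 2 + 1 = n + 3 from by ring]
    exact dvd_sub (Dvd.dvd.mul_left h1 _) (Dvd.dvd.mul_left h0 _)

/-- **`Φ_p(1+T)² ∣ v_n·v_{n+1}` for every `n`** (`v_0 v_1 = v_1 v_2 = 0` since `v_1 = 0`; two multiples of `Φ_p(1+T)` from
`n ≥ 2`). [cite: Sprung2017, Cor. 4.4] -/
theorem cyclotomic_comp_sq_dvd_flatPoly_mul_succ (a : ℤ) (p : ℕ) (n : ℕ) :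
    ((cyclotomic p ℤ).comp (X + 1)) ^ 2 ∣ flatPoly a p n * flatPoly a p (n + 1) := by
  rcases n with _ | _ | n
  · simp
  · simp
  · rw [pow_two, show n + 1 + 1 = n + 2 from rfl, show n + 2 + 1 = (n + 1) + 2 from rfl]
    exact mul_dvd_mul (cyclotomic_comp_dvd_flatPoly_add_two a p n) (cyclotomic_comp_dvd_flatPoly_add_two a p (n + 1))

end Divisibility

/-! ## §2 Twist matrices with `Φ_3(1+T)² ∣ (M_n)₁₀` -/

section Twist

variable {S : Type*} [CommRing S] (ψ : ℤ[X] →+* S) (σ : S →+* S) (b : ℤ)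

/-- **The twist matrices with the divisibility `Φ_3(1+T)² ∣ (M_n)₁₀`.** As `exists_twistMatrix_rowSeq` at `a = 3b`, with a
quotient `H_n ∈ ℤ[T]`, `(M_n)₁₀ = Φ_3(1+T)²·H_n` (`(E_{n+1})₁₀ = −T·g·v_n v_{n+1} ∈ Φ_3(1+T)²ℤ[T]`).
[cite: Sprung2017, §3.4 Prop. 3.14 and Cor. 4.4] -/
theorem exists_twistMatrix_rowSeq_lowerCyc (hC : σ (ψ (C (3 * b))) = ψ (C (3 * b)))
    (hΦ : ∀ m : ℕ, ∃ w : S, σ (ψ ((cyclotomic (3 ^ (m + 1)) ℤ).comp (X + 1))) =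
        w * ψ ((cyclotomic (3 ^ (m + 1)) ℤ).comp (X + 1)) ∧ ψ ((X + 1) ^ (2 * 3 ^ m)) * w = 1)
    (n : ℕ) :
    ∃ M : Matrix (Fin 2) (Fin 2) ℤ[X], (∃ H : ℤ[X], M 1 0 = ((cyclotomic 3 ℤ).comp (X + 1)) ^ 2 * H) ∧
      ∀ m : ℕ, (m = n + 1 ∨ m = n) → ∀ i : Fin 2,
        ψ (rowSeq (3 * b) 3 i m) =
          ψ (M i 0) * σ (ψ (rowSeq (3 * b) 3 0 m)) + ψ (M i 1) * σ (ψ (rowSeq (3 * b) 3 1 m)) := by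
  induction n with
  | zero =>
    refine ⟨1, ⟨0, by simp⟩, fun m hm i => ?_⟩
    rcases hm with rfl | rfl <;> fin_cases i <;> simp [rowSeq, Matrix.one_apply]
  | succ n ih =>
    obtain ⟨M, ⟨H, hH⟩, hM⟩ := ih
    set a : ℤ := 3 * b with ha
    set E : Matrix (Fin 2) (Fin 2) ℤ[X] :=
      !![1 - X * ((X + 1) ^ 3 ^ n + 1) * sharpPoly a 3 n * flatPoly a 3 (n + 1),
          X * ((X + 1) ^ 3 ^ n + 1) * sharpPoly a 3 n * sharpPoly a 3 (n + 1);
        -(X * ((X + 1) ^ 3 ^ n + 1) * flatPoly a 3 n * flatPoly a 3 (n + 1)),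
          1 + X * ((X + 1) ^ 3 ^ n + 1) * flatPoly a 3 n * sharpPoly a 3 (n + 1)] with hEdef
    have hE00 : E 0 0 = 1 - X * ((X + 1) ^ 3 ^ n + 1) * sharpPoly a 3 n * flatPoly a 3 (n + 1) := rfl
    have hE01 : E 0 1 = X * ((X + 1) ^ 3 ^ n + 1) * sharpPoly a 3 n * sharpPoly a 3 (n + 1) := rfl
    have hE10 : E 1 0 = -(X * ((X + 1) ^ 3 ^ n + 1) * flatPoly a 3 n * flatPoly a 3 (n + 1)) := rfl
    have hE11 : E 1 1 = 1 + X * ((X + 1) ^ 3 ^ n + 1) * flatPoly a 3 n * sharpPoly a 3 (n + 1) := rfl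
    have hdet := X_mul_det_rowSeq a n
    have hP1 : ∀ i : Fin 2, E i 0 * sharpPoly a 3 (n + 1) + E i 1 * flatPoly a 3 (n + 1) = rowSeq a 3 i (n + 1) := by
      intro i
      fin_cases i
      · simp only [Fin.zero_eta, Fin.isValue, hE00, hE01, rowSeq_zero]
        ring
      · simp only [Fin.mk_one, Fin.isValue, hE10, hE11, rowSeq_one]
        ring
    have hP2 : ∀ i : Fin 2, E i 0 * sharpPoly a 3 n + E i 1 * flatPoly a 3 n =
        (X + 1) ^ (2 * 3 ^ n) * rowSeq a 3 i n := by
      intro i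
      fin_cases i
      · simp only [Fin.zero_eta, Fin.isValue, hE00, hE01, rowSeq_zero]
        linear_combination (((X + 1) ^ 3 ^ n + 1) * sharpPoly a 3 n) * hdet
      · simp only [Fin.mk_one, Fin.isValue, hE10, hE11, rowSeq_one]
        linear_combination (((X + 1) ^ 3 ^ n + 1) * flatPoly a 3 n) * hdet
    have hU1 := hM (n + 1) (Or.inl rfl) 0
    have hV1 := hM (n + 1) (Or.inl rfl) 1
    have hU0 := hM n (Or.inr rfl) 0
    have hV0 := hM n (Or.inr rfl) 1
    simp only [rowSeq_zero, rowSeq_one] at hU1 hV1 hU0 hV0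
    -- the divisibility invariant
    have hinv : ∃ H' : ℤ[X], (E * M) 1 0 = ((cyclotomic 3 ℤ).comp (X + 1)) ^ 2 * H' := by
      obtain ⟨w, hw⟩ := cyclotomic_comp_sq_dvd_flatPoly_mul_succ a 3 n
      refine ⟨-(X * ((X + 1) ^ 3 ^ n + 1) * w) * M 0 0 + E 1 1 * H, ?_⟩
      rw [Matrix.mul_apply, Fin.sum_univ_two, hH, hE10, mul_assoc (X * ((X + 1) ^ 3 ^ n + 1)), hw]
      ring
    refine ⟨E * M, hinv, fun m hm i => ?_⟩
    have hEM : ∀ l : Fin 2, (E * M) i l = E i 0 * M 0 l + E i 1 * M 1 l := fun l => by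
      rw [Matrix.mul_apply, Fin.sum_univ_two]
    have hP1i := congrArg ψ (hP1 i)
    have hP2i := congrArg ψ (hP2 i)
    simp only [map_add, map_mul] at hP1i hP2i
    rw [rowSeq_zero, rowSeq_one, hEM 0, hEM 1]
    simp only [map_add, map_mul]
    rcases hm with rfl | rfl
    · obtain ⟨w, hw, hw1⟩ := hΦ n
      have hrow : rowSeq a 3 i (n + 1 + 1) =
          C a * rowSeq a 3 i (n + 1) - (cyclotomic (3 ^ (n + 1)) ℤ).comp (X + 1) * rowSeq a 3 i n := by
        fin_cases i
        · exact sharpPoly_add_two a 3 n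
        · exact flatPoly_add_two a 3 n
      rw [hrow, sharpPoly_add_two, flatPoly_add_two]
      simp only [map_sub, map_mul, hC, hw]
      linear_combination (ψ (C a) * ψ (E i 0)) * hU1 + (ψ (C a) * ψ (E i 1)) * hV1 +
        (-(w * ψ ((cyclotomic (3 ^ (n + 1)) ℤ).comp (X + 1)) * ψ (E i 0))) * hU0 +
        (-(w * ψ ((cyclotomic (3 ^ (n + 1)) ℤ).comp (X + 1)) * ψ (E i 1))) * hV0 +
        (-ψ (C a)) * hP1i + (w * ψ ((cyclotomic (3 ^ (n + 1)) ℤ).comp (X + 1))) * hP2i +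
        (ψ ((cyclotomic (3 ^ (n + 1)) ℤ).comp (X + 1)) * ψ (rowSeq a 3 i n)) * hw1
    · linear_combination ψ (E i 0) * hU1 + ψ (E i 1) * hV1 + (-1 : S) * hP1i

end Twist

/-! ## §3 The approximants with the divisibility invariant -/

section Approximants

/-- An integer polynomial read in `ℚ_3⟦T⟧` through `Λ` is its image through `ℚ` (private plumbing). [folklore] -/
private theorem coe_map_map_eq₇ (q : ℤ[X]) :
    (((q.map (Int.castRingHom ℚ)).map (algebraMap ℚ ℚ_[3]) : ℚ_[3][X]) : PowerSeries ℚ_[3]) =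
      (iwasawaToPowerSeries 3).comp (toIwasawa 3) q := by
  rw [RingHom.comp_apply]
  change _ = PowerSeries.map (algebraMap ℤ_[3] ℚ_[3])
    (((q.map (Int.castRingHom ℤ_[3])) : ℤ_[3][X]) : PowerSeries ℤ_[3])
  rw [← Polynomial.polynomial_map_coe, Polynomial.map_map, Polynomial.map_map,
    RingHom.ext_int ((algebraMap ℤ_[3] ℚ_[3]).comp (Int.castRingHom ℤ_[3]))
      ((algebraMap ℚ ℚ_[3]).comp (Int.castRingHom ℚ))]

/-- The image of `T + 1` (private plumbing). [folklore] -/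
private theorem psi_X_add_one₇ :
    (iwasawaToPowerSeries 3).comp (toIwasawa 3) (X + 1) = PowerSeries.X + 1 := by
  rw [← coe_map_map_eq₇]
  simp

/-- The image of a constant (private plumbing). [folklore] -/
private theorem psi_C₇ (c : ℤ) :
    (iwasawaToPowerSeries 3).comp (toIwasawa 3) (C c) = PowerSeries.C (c : ℚ_[3]) := by
  rw [← coe_map_map_eq₇, Polynomial.map_C, Polynomial.map_C, Polynomial.coe_C, eq_intCast, eq_ratCast,
    Rat.cast_intCast]

variable (b : ℤ)

/-- The entries of `A_n` read in `ℚ_3⟦T⟧` (private plumbing). [cite: Sprung2017, §3.1] -/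
private theorem coe_map_halfLogApprox_eq₇ (n : ℕ) (i k : Fin 2) :
    (((halfLogApprox 3 (3 * b) n i k).map (algebraMap ℚ ℚ_[3]) : ℚ_[3][X]) : PowerSeries ℚ_[3]) =
      (iwasawaToPowerSeries 3).comp (toIwasawa 3) (rowSeq (3 * b) 3 i (n + 1)) *
          PowerSeries.C ((((sprungCinv 3 (3 * b)) ^ (n + 2)) 0 k : ℚ) : ℚ_[3]) +
        (iwasawaToPowerSeries 3).comp (toIwasawa 3) (rowSeq (3 * b) 3 i n) *
          PowerSeries.C ((((sprungCinv 3 (3 * b)) ^ (n + 2)) 1 k : ℚ) : ℚ_[3]) := by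
  simp only [halfLogApprox, Polynomial.map_add, Polynomial.map_mul, Polynomial.map_C, Polynomial.coe_add,
    Polynomial.coe_mul, Polynomial.coe_C, coe_map_map_eq₇, eq_ratCast]

/-- **`A_n = M_n·A_n(T^ι)`** with the twist matrix of `exists_twistMatrix_rowSeq_lowerCyc`.
[cite: Sprung2017, §3.4 Prop. 3.14 and §3.1] -/
theorem exists_twistMatrix_halfLogApprox_lowerCyc (n : ℕ) :
    ∃ M : Matrix (Fin 2) (Fin 2) ℤ[X], (∃ H : ℤ[X], M 1 0 = ((cyclotomic 3 ℤ).comp (X + 1)) ^ 2 * H) ∧ ∀ i k : Fin 2,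
      (((halfLogApprox 3 (3 * b) n i k).map (algebraMap ℚ ℚ_[3]) : ℚ_[3][X]) : PowerSeries ℚ_[3]) =
        iwasawaToPowerSeries 3 (toIwasawa 3 (M i 0)) *
            PowerSeries.subst (invOnePlusSubOne : PowerSeries ℚ_[3])
              (((halfLogApprox 3 (3 * b) n 0 k).map (algebraMap ℚ ℚ_[3]) : ℚ_[3][X]) : PowerSeries ℚ_[3]) +
          iwasawaToPowerSeries 3 (toIwasawa 3 (M i 1)) *
            PowerSeries.subst (invOnePlusSubOne : PowerSeries ℚ_[3])
              (((halfLogApprox 3 (3 * b) n 1 k).map (algebraMap ℚ ℚ_[3]) : ℚ_[3][X]) : PowerSeries ℚ_[3]) := by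
  have hι := hasSubst_invOnePlusSubOne (R := ℚ_[3])
  set ψ : ℤ[X] →+* PowerSeries ℚ_[3] := (iwasawaToPowerSeries 3).comp (toIwasawa 3) with hψ
  set σ : PowerSeries ℚ_[3] →+* PowerSeries ℚ_[3] := (PowerSeries.substAlgHom hι).toRingHom with hσ
  have hσapp : ∀ x : PowerSeries ℚ_[3], σ x = PowerSeries.subst (invOnePlusSubOne : PowerSeries ℚ_[3]) x :=
    fun x => by rw [hσ, AlgHom.toRingHom_eq_coe, RingHom.coe_coe, PowerSeries.coe_substAlgHom]
  have hC : σ (ψ (C (3 * b))) = ψ (C (3 * b)) := by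
    rw [hψ, psi_C₇, PowerSeries.C_eq_algebraMap, hσ, AlgHom.toRingHom_eq_coe, RingHom.coe_coe, AlgHom.commutes]
  have hΦ : ∀ m : ℕ, ∃ w : PowerSeries ℚ_[3], σ (ψ ((cyclotomic (3 ^ (m + 1)) ℤ).comp (X + 1))) =
      w * ψ ((cyclotomic (3 ^ (m + 1)) ℤ).comp (X + 1)) ∧ ψ ((X + 1) ^ (2 * 3 ^ m)) * w = 1 := by
    intro m
    refine ⟨(invOnePlusSubOne + 1 : PowerSeries ℚ_[3]) ^ (2 * 3 ^ m), ?_, ?_⟩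
    · have hq : ψ ((cyclotomic (3 ^ (m + 1)) ℤ).comp (X + 1)) =
          (1 + PowerSeries.X : PowerSeries ℚ_[3]) ^ (2 * 3 ^ m) + (1 + PowerSeries.X) ^ 3 ^ m + 1 := by
        rw [cyclotomic_three_pow_succ_comp, map_add, map_add, map_pow, map_pow, map_one, hψ, psi_X_add_one₇,
          add_comm PowerSeries.X 1]
      rw [hq, hσapp, subst_invOnePlusSubOne_cyclotomicFactor]
    · have hE : (1 + PowerSeries.X : PowerSeries ℚ_[3]) * (invOnePlusSubOne + 1) = 1 :=
        one_add_X_mul_invOnePlusSubOne_add_one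
      rw [map_pow, hψ, psi_X_add_one₇, add_comm PowerSeries.X 1, ← mul_pow, hE, one_pow]
  obtain ⟨M, hinv, hM⟩ := exists_twistMatrix_rowSeq_lowerCyc ψ σ b hC hΦ n
  refine ⟨M, hinv, fun i k => ?_⟩
  have e1 := hM (n + 1) (Or.inl rfl) i
  have e0 := hM n (Or.inr rfl) i
  rw [coe_map_halfLogApprox_eq₇, coe_map_halfLogApprox_eq₇, coe_map_halfLogApprox_eq₇, ← hψ, ← hσapp, ← hσapp]
  simp only [map_add, map_mul]
  have hc0 : σ (PowerSeries.C ((((sprungCinv 3 (3 * b)) ^ (n + 2)) 0 k : ℚ) : ℚ_[3])) =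
      PowerSeries.C ((((sprungCinv 3 (3 * b)) ^ (n + 2)) 0 k : ℚ) : ℚ_[3]) := by
    rw [PowerSeries.C_eq_algebraMap, hσ, AlgHom.toRingHom_eq_coe, RingHom.coe_coe, AlgHom.commutes]
  have hc1 : σ (PowerSeries.C ((((sprungCinv 3 (3 * b)) ^ (n + 2)) 1 k : ℚ) : ℚ_[3])) =
      PowerSeries.C ((((sprungCinv 3 (3 * b)) ^ (n + 2)) 1 k : ℚ) : ℚ_[3]) := by
    rw [PowerSeries.C_eq_algebraMap, hσ, AlgHom.toRingHom_eq_coe, RingHom.coe_coe, AlgHom.commutes]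
  rw [hc0, hc1]
  linear_combination (PowerSeries.C ((((sprungCinv 3 (3 * b)) ^ (n + 2)) 0 k : ℚ) : ℚ_[3])) * e1 +
    (PowerSeries.C ((((sprungCinv 3 (3 * b)) ^ (n + 2)) 1 k : ℚ) : ℚ_[3])) * e0

end Approximants

/-! ## §4 The limit with the divisibility invariant -/

section Limit

/-- `[T^e] G(ι)` as a finite sum (private plumbing). [folklore] -/
private theorem coeff_subst_invOnePlusSubOne_eq_sum₇ (G : PowerSeries ℚ_[3]) (e : ℕ) :
    PowerSeries.coeff e (PowerSeries.subst (invOnePlusSubOne : PowerSeries ℚ_[3]) G) =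
      ∑ d ∈ Finset.range (e + 1), PowerSeries.coeff d G *
        PowerSeries.coeff e ((invOnePlusSubOne : PowerSeries ℚ_[3]) ^ d) := by
  have h0 : PowerSeries.constantCoeff (invOnePlusSubOne : PowerSeries ℚ_[3]) = 0 := constantCoeff_invOnePlusSubOne
  rw [PowerSeries.coeff_subst' (PowerSeries.HasSubst.of_constantCoeff_zero' h0),
    finsum_eq_sum_of_support_subset _ (s := Finset.range (e + 1)) ?_]
  · simp only [smul_eq_mul]
  · intro d hd
    simp only [Function.mem_support, ne_eq, Finset.coe_range, Set.mem_Iio] at hd ⊢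
    by_contra hlt
    apply hd
    rw [PowerSeries.coeff_of_lt_order e (lt_of_lt_of_le (by exact_mod_cast (by omega : e < d))
      (natCast_le_order_pow h0 d)), smul_zero]

/-- **`ℒ(T) = M(T)·ℒ(T^ι)` with `M ∈ M₂(ℤ_3⟦T⟧)` and `Φ_3(1+T)² ∣ M₁₀`.** As `exists_integral_halfLogMatrix_eq_mul_subst`,
with the lower off-diagonal entry divisible by `Φ_3(1+T)² = ((1+T)² + (1+T) + 1)²` (the quotient polynomials are carried
through the compactness limit). [cite: Sprung2017, §3.4 Prop. 3.14, Cor. 4.4 and Cor. 4.6] [cite: GreenbergLNM1716, §1] -/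
theorem exists_integral_halfLogMatrix_lower_eq_mul_cyclotomic_sq (b : ℤ) :
    ∃ M : Matrix (Fin 2) (Fin 2) (PowerSeries ℤ_[3]),
      (∃ H : PowerSeries ℤ_[3],
        M 1 0 = (((1 + PowerSeries.X : PowerSeries ℤ_[3]) ^ 2 + (1 + PowerSeries.X) + 1) ^ 2) * H) ∧
      ∀ i k : Fin 2, halfLogMatrix b i k =
        iwasawaToPowerSeries 3 (M i 0) *
            PowerSeries.subst (invOnePlusSubOne : PowerSeries ℚ_[3]) (halfLogMatrix b 0 k) +
          iwasawaToPowerSeries 3 (M i 1) *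
            PowerSeries.subst (invOnePlusSubOne : PowerSeries ℚ_[3]) (halfLogMatrix b 1 k) := by
  classical
  choose Mn hinv hMn using exists_twistMatrix_halfLogApprox_lowerCyc b
  choose Hn hHn using hinv
  let s : ℕ → (Fin 2 → Fin 2 → ℕ → ℤ_[3]) := fun n i l j => (((Mn n i l).coeff j : ℤ) : ℤ_[3])
  obtain ⟨a, φ, hφ, ha⟩ := SeqCompactSpace.tendsto_subseq s
  have haZ : ∀ (i l : Fin 2) (j : ℕ), Tendsto (fun n => s (φ n) i l j) atTop (𝓝 (a i l j)) := fun i l j =>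
    tendsto_pi_nhds.mp (tendsto_pi_nhds.mp (tendsto_pi_nhds.mp ha i) l) j
  have ha' : ∀ (i l : Fin 2) (j : ℕ),
      Tendsto (fun n => (((Mn (φ n) i l).coeff j : ℤ) : ℚ_[3])) atTop (𝓝 ((a i l j : ℤ_[3]) : ℚ_[3])) := by
    intro i l j
    have h4 := (continuous_subtype_val.tendsto (a i l j)).comp (haZ i l j)
    refine h4.congr fun n => ?_
    simp [s, Function.comp]
  -- a further subsequence along which the quotients `H_n` converge coefficientwise
  let t : ℕ → (ℕ → ℤ_[3]) := fun n j => (((Hn (φ n)).coeff j : ℤ) : ℤ_[3])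
  obtain ⟨c, ψ, hψ, hc⟩ := SeqCompactSpace.tendsto_subseq t
  have hcZ : ∀ j : ℕ, Tendsto (fun n => t (ψ n) j) atTop (𝓝 (c j)) := fun j => tendsto_pi_nhds.mp hc j
  set θ : ℕ → ℕ := φ ∘ ψ with hθdef
  have hθ : StrictMono θ := hφ.comp hψ
  have haθ : ∀ (i l : Fin 2) (j : ℕ), Tendsto (fun n => s (θ n) i l j) atTop (𝓝 (a i l j)) := fun i l j =>
    (haZ i l j).comp hψ.tendsto_atTop
  have ha'θ : ∀ (i l : Fin 2) (j : ℕ),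
      Tendsto (fun n => (((Mn (θ n) i l).coeff j : ℤ) : ℚ_[3])) atTop (𝓝 ((a i l j : ℤ_[3]) : ℚ_[3])) := fun i l j =>
    (ha' i l j).comp hψ.tendsto_atTop
  -- the divisibility passes to the limit: `a 1 0 = D * mk c` coefficientwise
  set D : PowerSeries ℤ_[3] := ((1 + PowerSeries.X : PowerSeries ℤ_[3]) ^ 2 + (1 + PowerSeries.X) + 1) ^ 2 with hDdef
  have hDcoe : ((((cyclotomic 3 ℤ).comp (X + 1)) ^ 2).map (Int.castRingHom ℤ_[3]) : ℤ_[3][X]) = D := by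
    have e : (cyclotomic 3 ℤ).comp (X + 1) = (X + 1) ^ 2 + (X + 1) + 1 := by
      simp [Polynomial.cyclotomic_three]
    rw [e]
    simp only [Polynomial.map_pow, Polynomial.map_add, Polynomial.map_X, Polynomial.map_one, Polynomial.coe_pow,
      Polynomial.coe_add, Polynomial.coe_X, Polynomial.coe_one, hDdef, add_comm PowerSeries.X 1]
  have hdivlim : ∀ j : ℕ, a 1 0 j = PowerSeries.coeff j (D * PowerSeries.mk c) := by
    intro j
    -- at stage `θ n`: `coeff j (M_n)₁₀ = Σ_{x ∈ antidiag j} D_{x.1} (H_n)_{x.2}`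
    have hstage : ∀ n, s (θ n) 1 0 j = ∑ x ∈ Finset.HasAntidiagonal.antidiagonal j,
        PowerSeries.coeff x.1 D * t (ψ n) x.2 := by
      intro n
      have h := congrArg (fun q : ℤ[X] => ((q.map (Int.castRingHom ℤ_[3]) : ℤ_[3][X]) : PowerSeries ℤ_[3])) (hHn (θ n))
      simp only [Polynomial.map_mul, Polynomial.coe_mul, hDcoe] at h
      have h2 := congrArg (PowerSeries.coeff j) h
      rw [Polynomial.coeff_coe, Polynomial.coeff_map, PowerSeries.coeff_mul] at h2
      simp only [s, t, hθdef, Function.comp, Polynomial.coeff_coe, Polynomial.coeff_map, eq_intCast] at h2 ⊢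
      exact h2
    have hlim2 : Tendsto (fun n => s (θ n) 1 0 j) atTop
        (𝓝 (∑ x ∈ Finset.HasAntidiagonal.antidiagonal j, PowerSeries.coeff x.1 D * c x.2)) := by
      simp_rw [hstage]
      exact tendsto_finsetSum _ fun x _ => (hcZ x.2).const_mul _
    have := tendsto_nhds_unique (haθ 1 0 j) hlim2
    rw [this, PowerSeries.coeff_mul]
    simp only [PowerSeries.coeff_mk]
  refine ⟨fun i l => PowerSeries.mk (a i l), ⟨PowerSeries.mk c, ?_⟩, fun i k => ?_⟩
  · ext j
    rw [PowerSeries.coeff_mk]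
    exact hdivlim j
  ext j
  let T : (ℕ → ℚ_[3]) → (ℕ → ℚ_[3]) → ℚ_[3] := fun f g =>
    ∑ x ∈ Finset.HasAntidiagonal.antidiagonal j, f x.1 *
      ∑ d ∈ Finset.range (x.2 + 1), g d * PowerSeries.coeff x.2 ((invOnePlusSubOne : PowerSeries ℚ_[3]) ^ d)
  have hT : ∀ F G : PowerSeries ℚ_[3],
      PowerSeries.coeff j (F * PowerSeries.subst (invOnePlusSubOne : PowerSeries ℚ_[3]) G) =
        T (fun d => PowerSeries.coeff d F) (fun d => PowerSeries.coeff d G) := by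
    intro F G
    simp only [T, PowerSeries.coeff_mul, coeff_subst_invOnePlusSubOne_eq_sum₇]
  have hTlim : ∀ {f g : ℕ → ℕ → ℚ_[3]} {f₀ g₀ : ℕ → ℚ_[3]},
      (∀ d, Tendsto (fun n => f n d) atTop (𝓝 (f₀ d))) → (∀ d, Tendsto (fun n => g n d) atTop (𝓝 (g₀ d))) →
        Tendsto (fun n => T (f n) (g n)) atTop (𝓝 (T f₀ g₀)) := by
    intro f g f₀ g₀ hf hg
    exact tendsto_finsetSum _ fun x _ =>
      (hf x.1).mul (tendsto_finsetSum _ fun d _ => (hg d).mul_const _)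
  have hcM : ∀ (n : ℕ) (i l : Fin 2) (d : ℕ),
      PowerSeries.coeff d (iwasawaToPowerSeries 3 (toIwasawa 3 (Mn n i l))) = (((Mn n i l).coeff d : ℤ) : ℚ_[3]) := by
    intro n i l d
    change PowerSeries.coeff d (PowerSeries.map (algebraMap ℤ_[3] ℚ_[3])
      ((((Mn n i l).map (Int.castRingHom ℤ_[3])) : ℤ_[3][X]) : PowerSeries ℤ_[3])) = _
    rw [PowerSeries.coeff_map, Polynomial.coeff_coe, Polynomial.coeff_map]
    simp
  have hcMlim : ∀ (i l : Fin 2) (d : ℕ),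
      PowerSeries.coeff d (iwasawaToPowerSeries 3 (PowerSeries.mk (a i l))) = ((a i l d : ℤ_[3]) : ℚ_[3]) := by
    intro i l d
    rw [PowerSeries.coeff_map, PowerSeries.coeff_mk]
    rfl
  have hlhs : Tendsto (fun n => coeffSeq b (θ n) i k j) atTop (𝓝 (PowerSeries.coeff j (halfLogMatrix b i k))) :=
    (tendsto_coeffSeq b i k j).comp hθ.tendsto_atTop
  have heq : ∀ n : ℕ, coeffSeq b (θ n) i k j =
      T (fun d => (((Mn (θ n) i 0).coeff d : ℤ) : ℚ_[3])) (fun d => coeffSeq b (θ n) 0 k d) +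
        T (fun d => (((Mn (θ n) i 1).coeff d : ℤ) : ℚ_[3])) (fun d => coeffSeq b (θ n) 1 k d) := by
    intro n
    have h := congrArg (PowerSeries.coeff j) (hMn (θ n) i k)
    rw [coeff_coe_map_halfLogApprox, map_add, hT, hT] at h
    simp only [hcM, coeff_coe_map_halfLogApprox] at h
    exact h
  have hrhs : Tendsto (fun n => coeffSeq b (θ n) i k j) atTop
      (𝓝 (T (fun d => ((a i 0 d : ℤ_[3]) : ℚ_[3])) (fun d => PowerSeries.coeff d (halfLogMatrix b 0 k)) +
        T (fun d => ((a i 1 d : ℤ_[3]) : ℚ_[3])) (fun d => PowerSeries.coeff d (halfLogMatrix b 1 k)))) := by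
    simp_rw [heq]
    exact (hTlim (ha'θ i 0) fun d => (tendsto_coeffSeq b 0 k d).comp hθ.tendsto_atTop).add
      (hTlim (ha'θ i 1) fun d => (tendsto_coeffSeq b 1 k d).comp hθ.tendsto_atTop)
  have hlim := tendsto_nhds_unique hlhs hrhs
  rw [hlim, map_add, hT, hT]
  simp only [hcMlim]

end Limit


/-! ## §5 `M₁₀ = 3·T·Φ_3(1+T)²·(unit)` for `3 ∤ b` -/

section Final

/-- A power series with all coefficients divisible by `3` is `C(3)·G` (private plumbing). [folklore] -/
private theorem exists_eq_C_mul_of_forall_dvd₇ {M : PowerSeries ℤ_[3]} (h : ∀ j, (3 : ℤ_[3]) ∣ PowerSeries.coeff j M) :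
    ∃ G : PowerSeries ℤ_[3], M = PowerSeries.C (3 : ℤ_[3]) * G := by
  choose g hg using h
  refine ⟨PowerSeries.mk g, ?_⟩
  ext j
  rw [PowerSeries.coeff_C_mul, PowerSeries.coeff_mk, hg j]

/-- In `ℤ_3`: `(3 : ℤ_3) ∣ (k : ℤ)` iff `3 ∣ k` in `ℤ` (private plumbing). [folklore] -/
private theorem three_dvd_intCast_iff₇ (k : ℤ) : (3 : ℤ_[3]) ∣ (k : ℤ_[3]) ↔ (3 : ℤ) ∣ k := by
  have h1 := PadicInt.norm_lt_one_iff_dvd (p := 3) (k : ℤ_[3])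
  have h2 := PadicInt.norm_int_lt_one_iff_dvd (p := 3) k
  push_cast at h1 h2
  exact h1.symm.trans h2

/-- In `ℤ_3`: an element not divisible by `3` is a unit (private plumbing). [folklore] -/
private theorem isUnit_of_not_three_dvd₇ {x : ℤ_[3]} (hx : ¬ (3 : ℤ_[3]) ∣ x) : IsUnit x := by
  rw [PadicInt.isUnit_iff]
  have h1 := PadicInt.norm_lt_one_iff_dvd (p := 3) x
  push_cast at h1
  have hle := PadicInt.norm_le_one x
  by_contra hne
  exact hx (h1.mp (lt_of_le_of_ne hle hne))

/-- **BOTH OFF-DIAGONAL ENTRIES IN FINAL FORM (`3 ∤ b`)**: the unique integral transition matrix of `ℒ = M·ℒ(T^ι)` has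
`M₀₁ = C(3)·T·u` and `M₁₀ = C(3)·T·Φ_3(1+T)²·h` with `u, h ∈ Λˣ` (`Φ_3(1+T)² = ((1+T)² + (1+T) + 1)²`; `h(0) ≡ 4b mod 9`),
and `M₀₀(0) = M₁₁(0) = 1`. [cite: Sprung2017, §3.4 Prop. 3.14, Cor. 4.4 and Cor. 4.6] [cite: GreenbergLNM1716, §1] -/
theorem exists_integral_halfLogMatrix_offDiag_final (b : ℤ) (hb : ¬ (3 : ℤ) ∣ b) :
    ∃ M : Matrix (Fin 2) (Fin 2) (PowerSeries ℤ_[3]),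
      (∃ u : PowerSeries ℤ_[3], IsUnit u ∧ M 0 1 = PowerSeries.C (3 : ℤ_[3]) * PowerSeries.X * u) ∧
      (∃ h : PowerSeries ℤ_[3], IsUnit h ∧
        M 1 0 = PowerSeries.C (3 : ℤ_[3]) * PowerSeries.X *
          (((1 + PowerSeries.X : PowerSeries ℤ_[3]) ^ 2 + (1 + PowerSeries.X) + 1) ^ 2) * h) ∧
      PowerSeries.constantCoeff (M 0 0) = 1 ∧ PowerSeries.constantCoeff (M 1 1) = 1 ∧
      ∀ i k : Fin 2, halfLogMatrix b i k =
        iwasawaToPowerSeries 3 (M i 0) *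
            PowerSeries.subst (invOnePlusSubOne : PowerSeries ℚ_[3]) (halfLogMatrix b 0 k) +
          iwasawaToPowerSeries 3 (M i 1) *
            PowerSeries.subst (invOnePlusSubOne : PowerSeries ℚ_[3]) (halfLogMatrix b 1 k) := by
  -- the three descriptions of the (unique) transition matrix
  obtain ⟨M, hu, ⟨g, hg0, hM10g⟩, hM00, hM11, hM⟩ := exists_integral_halfLogMatrix_offDiag_both b hb
  obtain ⟨M₂, -, -, h243, hM₂⟩ := exists_integral_halfLogMatrix_eq_mul_subst_lower b
  obtain ⟨M₃, ⟨H, hH⟩, hM₃⟩ := exists_integral_halfLogMatrix_lower_eq_mul_cyclotomic_sq b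
  have h2 : M = M₂ := halfLogMatrix_transition_unique b hM hM₂
  have h3 : M = M₃ := halfLogMatrix_transition_unique b hM hM₃
  rw [← h2] at h243
  rw [← h3] at hH
  refine ⟨M, hu, ?_, hM00, hM11, hM⟩
  set D : PowerSeries ℤ_[3] := ((1 + PowerSeries.X : PowerSeries ℤ_[3]) ^ 2 + (1 + PowerSeries.X) + 1) ^ 2 with hDdef
  -- `D = X⁴ + 3·R` with `D(0) = 9`
  set R : PowerSeries ℤ_[3] := 2 * PowerSeries.X ^ 3 + 5 * PowerSeries.X ^ 2 + 6 * PowerSeries.X + 3 with hRdef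
  have hDR : D = PowerSeries.X ^ 4 + PowerSeries.C (3 : ℤ_[3]) * R := by
    rw [hDdef, hRdef, PowerSeries.C_eq_algebraMap, map_ofNat]
    ring
  have hD0 : PowerSeries.constantCoeff D = 9 := by
    rw [hDdef]
    simp
    norm_num
  -- `H(0) = 0`, so `H = X·H′`
  have hH0 : PowerSeries.constantCoeff H = 0 := by
    have h := congrArg PowerSeries.constantCoeff hH
    rw [hM10g] at h
    simp only [map_mul, PowerSeries.constantCoeff_X, mul_zero, zero_mul, hD0] at h
    rcases mul_eq_zero.mp h.symm with h9 | h0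
    · exact absurd h9 (by norm_num)
    · exact h0
  obtain ⟨H', hH'⟩ := PowerSeries.X_dvd_iff.mpr hH0
  -- `C(3)·g = D·H′`
  have hgD : PowerSeries.C (3 : ℤ_[3]) * g = D * H' := by
    have h : PowerSeries.X * (PowerSeries.C (3 : ℤ_[3]) * g) = PowerSeries.X * (D * H') := by
      calc PowerSeries.X * (PowerSeries.C (3 : ℤ_[3]) * g)
          = PowerSeries.C (3 : ℤ_[3]) * PowerSeries.X * g := by ring
        _ = M 1 0 := hM10g.symm
        _ = D * H := hH
        _ = PowerSeries.X * (D * H') := by rw [hH']; ring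
    exact mul_left_cancel₀ PowerSeries.X_ne_zero h
  -- every coefficient of `H′` is divisible by `3`: `X⁴·H′ = C(3)·(g − R·H′)`
  have hX4 : PowerSeries.X ^ 4 * H' = PowerSeries.C (3 : ℤ_[3]) * (g - R * H') := by
    have := hgD
    rw [hDR] at this
    linear_combination -this
  have hdvd : ∀ j, (3 : ℤ_[3]) ∣ PowerSeries.coeff j H' := by
    intro j
    have h := congrArg (PowerSeries.coeff (j + 4)) hX4
    rw [PowerSeries.coeff_X_pow_mul, PowerSeries.coeff_C_mul] at h
    exact ⟨_, h⟩
  obtain ⟨h, hh⟩ := exists_eq_C_mul_of_forall_dvd₇ hdvd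
  -- `g = D·h`
  have hgDh : g = D * h := by
    have h1 : PowerSeries.C (3 : ℤ_[3]) * g = PowerSeries.C (3 : ℤ_[3]) * (D * h) := by rw [hgD, hh]; ring
    exact mul_left_cancel₀ (by
      intro h0
      have := congrArg PowerSeries.constantCoeff h0
      rw [PowerSeries.constantCoeff_C, map_zero] at this
      exact absurd this (by norm_num)) h1
  -- `h(0)` is a unit: `g(0) = 9 h(0)` and `243 ∣ 3 g(0) − 108 b`
  have hg0eq : PowerSeries.constantCoeff g = 9 * PowerSeries.constantCoeff h := by
    rw [hgDh, map_mul, hD0]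
  have hcoeff1 : PowerSeries.coeff 1 (M 1 0) = 3 * PowerSeries.constantCoeff g := by
    have h1 : PowerSeries.coeff 1 (PowerSeries.X * g) = PowerSeries.constantCoeff g := by
      simp
    rw [hM10g, mul_assoc, PowerSeries.coeff_C_mul, h1]
  have hunit : IsUnit (PowerSeries.constantCoeff h) := by
    apply isUnit_of_not_three_dvd₇
    rintro ⟨t, ht⟩
    obtain ⟨q, hq⟩ := h243
    rw [hcoeff1, hg0eq, ht] at hq
    apply hb
    have h3 : ((4 * b : ℤ) : ℤ_[3]) * 27 = 3 * (t - 3 * q) * 27 := by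
      push_cast
      linear_combination -hq
    have h4b : (3 : ℤ_[3]) ∣ ((4 * b : ℤ) : ℤ_[3]) :=
      ⟨t - 3 * q, mul_right_cancel₀ (by norm_num : (27 : ℤ_[3]) ≠ 0) h3⟩
    have h4b' := (three_dvd_intCast_iff₇ (4 * b)).mp h4b
    have hcop : IsCoprime (3 : ℤ) 4 := ⟨-1, 1, by norm_num⟩
    exact hcop.dvd_of_dvd_mul_left h4b'
  refine ⟨h, (PowerSeries.isUnit_iff_constantCoeff (φ := h)).mpr hunit, ?_⟩
  rw [hM10g, hgDh, hDdef]
  ring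

end Final

end Literature.NumberTheory.EllipticCurves.Sprung2017

end
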